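import Mathlib
import Literature.NumberTheory.Sieve.MaynardSieveCounting2
import HarnessLib

/-!
# Maynard (2016), Lemma 7: regrouping the error terms by the modulus — display (6.31)

Trunk: AntSieve / parity (Maynard 2016 large-gaps ladder; named fact
`Literature.NumberTheory.Sieve.Maynard2016.Lemma7Tuple`).

J. Maynard, *Large gaps between primes*, Ann. of Math. 183 (2016) = arXiv:1408.5110, §6, proof of
Lemma 7, display (6.31) (p. 12): the error `E(x; r)` of (6.29) is attached to the modulus
`r = rad(∏ d_j d'_j e_j e'_j …)`, "`r ≪ x^{1/5+o_k(1)}` from the support conditions", and each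
squarefree `r` arises from `≪ τ_{k²+4k}(r)` tuples, so that the total error is
`≪_k Σ_{r ≪ x^{1/5+ε}} τ_{O(k)}(r) E(x; r)`.  This is the 2016 analogue of the tree's
`MaynardSieve.sum_pairs_le_sum_moduli` (Maynard 2015, Lemma 5.2), with the same crude multiplicity
`τ(r)^{n} = (2^n)^{ω(r)}` for tuples with `n` squarefree coordinates.

PROVED here (generic over a finite coordinate type `κ`, so that the successor can take
`κ = Fin 4 × Fin k` for the quadruples `(d, d', e, e')`):
`Maynard2016.sum_rad_le_sum_sqf_pow_omega : Σ_{a ∈ S} f(rad ∏_i a_i) ≤ Σ_{r ≤ M, r sqf} (2^{#κ})^{ω(r)} f(r)`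
for `f ≥ 0`, tuples `a ∈ S` with squarefree coordinates, `∏_i a_i ≤ M`, `S` separated by its
coordinates; together with the pointwise facts `rad_pos`, `rad_le`, `squarefree_rad`,
`dvd_rad_of_dvd` used to place `r`.

## References

* J. Maynard, *Large gaps between primes*, Ann. of Math. (2) 183 (2016), 915–933; arXiv:1408.5110,
  §6, proof of Lemma 7, display (6.31). [Maynard2016LargeGaps]
-/

open Finset
open scoped BigOperators ArithmeticFunction.omega

namespace Literature.NumberTheory.Sieve

namespace Maynard2016

/-! ### The radical `∏_{p ∣ m} p` -/

/-- `0 < ∏_{p ∣ m} p`. [folklore] -/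
private theorem rad_pos (m : ℕ) : 0 < ∏ p ∈ m.primeFactors, p :=
  Finset.prod_pos fun _ hp => (Nat.prime_of_mem_primeFactors hp).pos

/-- `∏_{p ∣ m} p ≤ m` for `m ≠ 0`. [folklore] -/
private theorem rad_le {m : ℕ} (hm : m ≠ 0) : ∏ p ∈ m.primeFactors, p ≤ m :=
  Nat.le_of_dvd (Nat.pos_of_ne_zero hm) (Nat.prod_primeFactors_dvd m)

/-- `∏_{p ∣ m} p` is squarefree. [folklore] -/
private theorem squarefree_rad (m : ℕ) : Squarefree (∏ p ∈ m.primeFactors, p) := by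
  classical
  suffices h : ∀ T : Finset ℕ, (∀ p ∈ T, p.Prime) → Squarefree (∏ p ∈ T, p) from
    h _ fun _ hp => Nat.prime_of_mem_primeFactors hp
  intro T hT
  induction T using Finset.induction_on with
  | empty => simp
  | insert a T haT ih =>
    rw [Finset.prod_insert haT]
    have ha := hT a (Finset.mem_insert_self a T)
    have hT' : ∀ p ∈ T, p.Prime := fun p hp => hT p (Finset.mem_insert_of_mem hp)
    refine (Nat.squarefree_mul ?_).2 ⟨ha.squarefree, ih hT'⟩
    exact Nat.Coprime.prod_right fun p hp => (Nat.coprime_primes ha (hT' p hp)).2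
      (fun h => haT (h ▸ hp))

/-- A squarefree divisor of `m ≠ 0` divides `∏_{p ∣ m} p`. [folklore] -/
private theorem dvd_rad_of_dvd {d m : ℕ} (hd : Squarefree d) (hdm : d ∣ m) (hm : m ≠ 0) :
    d ∣ ∏ p ∈ m.primeFactors, p := by
  calc d = ∏ p ∈ d.primeFactors, p := (Nat.prod_primeFactors_of_squarefree hd).symm
    _ ∣ ∏ p ∈ m.primeFactors, p :=
        Finset.prod_dvd_prod_of_subset _ _ _ (Nat.primeFactors_mono hdm hm)

/-! ### Regrouping -/

/-- **Display (6.31), the regrouping**: for `f ≥ 0` and a finite set `S` of tuples `a : κ → ℕ`-valued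
coordinates (`coord a`), all squarefree, with `∏_i coord a i ≤ M` and `coord` injective on `S`,
`Σ_{a ∈ S} f(∏_{p ∣ ∏_i coord a i} p) ≤ Σ_{1 ≤ r ≤ M, r squarefree} (2^{#κ})^{ω(r)} f(r)`
(each squarefree `r` is the radical for at most `τ(r)^{#κ}` tuples, all coordinates dividing `r`).
[cite: Maynard2016LargeGaps, Lemma 7 (proof, display (6.31))] -/
theorem sum_rad_le_sum_sqf_pow_omega {α κ : Type*} [DecidableEq α] [Fintype κ] [DecidableEq κ]
    (S : Finset α) (coord : α → κ → ℕ) (M : ℕ)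
    (hsq : ∀ a ∈ S, ∀ i, Squarefree (coord a i)) (hM : ∀ a ∈ S, ∏ i, coord a i ≤ M)
    (hinj : Set.InjOn coord S) {f : ℕ → ℝ} (hf : ∀ r, 0 ≤ f r) :
    ∑ a ∈ S, f (∏ p ∈ (∏ i, coord a i).primeFactors, p) ≤
      ∑ r ∈ (Finset.Icc 1 M).filter Squarefree, ((2 : ℝ) ^ Fintype.card κ) ^ ω r * f r := by
  classical
  set g : α → ℕ := fun a => ∏ p ∈ (∏ i, coord a i).primeFactors, p with hg
  set T := (Finset.Icc 1 M).filter Squarefree with hT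
  have hm0 : ∀ a ∈ S, ∏ i, coord a i ≠ 0 := fun a ha =>
    Finset.prod_ne_zero_iff.2 fun i _ => (hsq a ha i).ne_zero
  have hmaps : ∀ a ∈ S, g a ∈ T := by
    intro a ha
    rw [hT, Finset.mem_filter, Finset.mem_Icc]
    exact ⟨⟨rad_pos _, (rad_le (hm0 a ha)).trans (hM a ha)⟩, squarefree_rad _⟩
  have hlhs : ∑ a ∈ S, f (g a) = ∑ r ∈ T, ∑ a ∈ S.filter (fun a => g a = r), f (g a) :=
    (Finset.sum_fiberwise_of_maps_to hmaps _).symm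
  change ∑ a ∈ S, f (g a) ≤ _
  rw [hlhs]
  refine Finset.sum_le_sum fun r hr => ?_
  have hrsq : Squarefree r := (Finset.mem_filter.1 hr).2
  have hr0 : r ≠ 0 := hrsq.ne_zero
  -- on the fibre, `f (g a) = f r`
  have hfib : ∑ a ∈ S.filter (fun a => g a = r), f (g a) =
      ((S.filter (fun a => g a = r)).card : ℝ) * f r := by
    rw [Finset.sum_congr rfl fun a ha => by rw [(Finset.mem_filter.1 ha).2], Finset.sum_const,
      nsmul_eq_mul]
  rw [hfib]
  refine mul_le_mul_of_nonneg_right ?_ (hf r)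
  -- the fibre injects into `(divisors r)^κ`
  have hcard : (S.filter (fun a => g a = r)).card ≤
      (Fintype.piFinset fun _ : κ => r.divisors).card := by
    refine Finset.card_le_card_of_injOn coord (fun a ha => ?_) fun a ha b hb hab =>
      hinj (Finset.mem_filter.1 ha).1 (Finset.mem_filter.1 hb).1 hab
    obtain ⟨haS, har⟩ := Finset.mem_filter.1 ha
    rw [Finset.mem_coe, Fintype.mem_piFinset]
    intro i
    rw [Nat.mem_divisors]
    refine ⟨?_, hr0⟩
    rw [← har]
    exact dvd_rad_of_dvd (hsq a haS i) (Finset.dvd_prod_of_mem _ (Finset.mem_univ i)) (hm0 a haS)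
  rw [Fintype.card_piFinset, Finset.prod_const, Finset.card_univ,
    MaynardSieve.card_divisors_of_squarefree hrsq] at hcard
  calc ((S.filter (fun a => g a = r)).card : ℝ) ≤ ((2 ^ ω r) ^ Fintype.card κ : ℕ) := by
        exact_mod_cast hcard
    _ = ((2 : ℝ) ^ Fintype.card κ) ^ ω r := by push_cast; rw [← pow_mul, ← pow_mul, mul_comm]

/-- **Weighted form**: with weights `|w a| ≤ W` (`W ≥ 0`) on the tuples,
`Σ_{a ∈ S} |w a| f(rad_a) ≤ W Σ_{r ≤ M sqf} (2^{#κ})^{ω(r)} f(r)`. [cite: Maynard2016LargeGaps, Lemma 7 (proof, display (6.31))] -/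
theorem sum_mul_rad_le {α κ : Type*} [DecidableEq α] [Fintype κ] [DecidableEq κ]
    (S : Finset α) (coord : α → κ → ℕ) (M : ℕ)
    (hsq : ∀ a ∈ S, ∀ i, Squarefree (coord a i)) (hM : ∀ a ∈ S, ∏ i, coord a i ≤ M)
    (hinj : Set.InjOn coord S) {f : ℕ → ℝ} (hf : ∀ r, 0 ≤ f r) {w : α → ℝ} {W : ℝ}
    (hW0 : 0 ≤ W) (hw : ∀ a ∈ S, |w a| ≤ W) :
    ∑ a ∈ S, |w a| * f (∏ p ∈ (∏ i, coord a i).primeFactors, p) ≤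
      W * ∑ r ∈ (Finset.Icc 1 M).filter Squarefree, ((2 : ℝ) ^ Fintype.card κ) ^ ω r * f r := by
  have hW : ∀ a ∈ S, |w a| * f (∏ p ∈ (∏ i, coord a i).primeFactors, p) ≤
      W * f (∏ p ∈ (∏ i, coord a i).primeFactors, p) := fun a ha =>
    mul_le_mul_of_nonneg_right (hw a ha) (hf _)
  refine (Finset.sum_le_sum hW).trans ?_
  rw [← Finset.mul_sum]
  exact mul_le_mul_of_nonneg_left (sum_rad_le_sum_sqf_pow_omega S coord M hsq hM hinj hf) hW0

end Maynard2016

end Literature.NumberTheory.Sieve
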